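import Literature.Probability.Percolation.ArmSeparationOutRouteFour
import Literature.Probability.Percolation.ArmSeparationOutLandingFour
import Literature.Probability.Percolation.ArmSeparationOutFramesFour
import HarnessLib

/-!
# The four-arm outer landing: the slots cover `OutMidTiny4`, and the landing inequality at `p`

Topic `Literature/Probability/Percolation`; family `crit-perc` / near-critical percolation on `𝕋`.
A brick of the near-critical arm-separation theorem for four arms of alternating colours
(P. Nolin, *Near-critical percolation in two dimensions*, EJP 13 (2008), Thm. 11 for `j = 4`,
`σ = BWBW` [arXiv 0711.4948: Thm. 10], landing step of the outer induction, §4.4 p. 12 with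
Prop. 12 (i)). The event `OutMidTiny4` (four fenced outer arms of alternating colours with middle
tips, in the anticlockwise order of `∂Λ_{2M}`; `ArmSeparationOutFramesFour`) is covered by the routed
slots of `ArmSeparationOutSlotsFour` (`exists_slot_of_mem`): the tip data of the configuration is
good tip data in the sense of `ArmSeparationOutRouteFour` (row gaps of fenced tips of different
colours from `row_gap_of_lt`, the order certificate read through `sbtw_of_hexShift_lt` and
`frame_eq_and_row_sbtw`), so the routed slot of that file is in range, routed, and holds the four
arms. With the per-slot landing bound of `ArmSeparationOutLandingFour` (`real_biUnion_arms_le`) this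
gives the landing inequality at a general parameter `p` (`real_outMidTiny4_le_at`):
`P_p(OutMidTiny4) (c_F c^{B+3})⁴ ≤ #slots · P_p(extFourArmQ n 4M)`, with RSW inputs at `p` and `1 - p`.

Everything here is proved; no named facts are introduced.

## References

* P. Nolin, Near-critical percolation in two dimensions, *Electron. J. Probab.* 13 (2008), §4.3
  Prop. 12 (i), Lemma 13, §4.4 (arXiv 0711.4948: Prop. 11, Lemma 12; proof of Thm. 10, p. 12) [Nolin2008].
* H. Kesten, Scaling relations for 2D-percolation, *Comm. Math. Phys.* 109 (1987), Lemmas 4–6 [Kesten1987].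
-/

namespace Literature.Probability.Percolation

open Set MeasureTheory Lanes
open LatticeModels

/-! ### Facts about fenced tips -/

/-- The framed tip of a fenced outer arm has norm `2M`. [folklore] -/
theorem TrapFencedArm.triNorm_frameIso_z {M n k₀ K i : ℕ} (hi : i < 6) {χ : SiteConfig (Site 2)}
    (F : TrapFencedArm M n k₀ K χ) : triNorm (frameIso i F.z) = 2 * M := by
  rw [triNorm_frameIso i hi]
  have := mem_trapD.1 (mem_trapO.1 F.z_mem).1
  have h2 := (mem_trapO.1 F.z_mem).2
  rw [triNorm_eq_max]
  have h0 := trapO_coord F.z_mem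
  omega

/-- **Row gap of fenced outer arms of complementary configurations** (`row_gap_of_lt`, either order). [cite: Nolin2008, §4.4 Lemma 15 (proof) (arXiv 0711.4948: Lemma 14)] -/
theorem TrapFencedArm.zgap_compl {M n k₀ K : ℕ} (hnM : n ≤ M) (hk₀ : 1 ≤ k₀) (hKM : ∀ j < K, 128 * (trapScale k₀ j : ℤ) < M)
    {χ χ' : SiteConfig (Site 2)} (hχ : χ' = χᶜ) (Fo : TrapFencedArm M n k₀ K χ) (Fc : TrapFencedArm M n k₀ K χ') :
    Fo.z 1 + 8 * Fo.k < Fc.z 1 ∨ Fc.z 1 + 8 * Fc.k < Fo.z 1 := by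
  subst hχ
  have hcol : ∀ v, v ∈ χᶜ → v ∉ χ := fun v hv hv' => hv hv'
  have hcol' : ∀ v, v ∈ χ → v ∉ χᶜ := fun v hv hv' => hv' hv
  have hne : Fo.z 1 ≠ Fc.z 1 := fun h => by
    have heq : Fo.z = Fc.z := eq_of_mem_trapO Fo.z_mem Fc.z_mem h
    have h1 := Fo.z_mem_config
    rw [heq] at h1
    exact Fc.z_mem_config h1
  rcases lt_or_gt_of_ne hne with hlt | hlt
  · exact Or.inl (row_gap_of_lt hnM hk₀ hKM hcol Fo Fc hlt)
  · exact Or.inr (row_gap_of_lt hnM hk₀ hKM hcol' Fc Fo hlt)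

/-- The perimeter coordinate of a framed tip is the key of its row. [folklore] -/
theorem hexPos_frameIso_eq_frKey {M : ℕ} {z : Site 2} (hz : z ∈ trapO M) (hz1 : -(2 * (M : ℤ)) < z 1) {i : ℕ} (hi : i < 6) :
    hexPos (2 * M) (frameIso i z) = frKey M i (z 1) := by
  obtain ⟨f0, f1, f2, f3, f4, f5⟩ := hexPos_frameIso_trapO hz hz1
  interval_cases i
  · rw [f0, frKey_zero]
  · rw [f1, frKey_one]
  · rw [f2, frKey_two]
  · rw [f3, frKey_three]
  · rw [f4, frKey_four]
  · rw [f5, frKey_five]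

/-- The shifted perimeter coordinate is the anticlockwise distance of the perimeter coordinates. [folklore] -/
theorem hexShift_eq_cyc (N : ℕ) (r v : Site 2) : hexShift N r v = cyc (6 * (N : ℤ)) (hexPos N r) (hexPos N v) := by
  unfold hexShift cyc; rfl

/-- Betweenness is symmetric in the outer points. [folklore] -/
theorem SBtw.symm' {x y z : ℤ} (h : SBtw x y z) : SBtw z y x := by unfold SBtw at h ⊢; tauto

/-! ### The slots cover `OutMidTiny4` -/

/-- **Every configuration of `OutMidTiny4` lies in the arm event of a routed slot in range.** [cite: Nolin2008, §4.4 p. 12 with §4.3 Prop. 12 (i) (arXiv 0711.4948: proof of Thm. 10; Prop. 11)] -/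
theorem exists_slot_of_mem {P : OParams} (hV : P.Valid) {ω : SiteConfig (Site 2)} (hω : ω ∈ OutMidTiny4 P.M P.n P.k₀ P.K P.R₀) :
    ∃ σ ∈ slot4Finset P, σ.InRange P ∧ Slot4.RouteOK P σ ∧ ω ∈ ⋂ e, σ.armE P e := by
  obtain ⟨i, hi, F₀, F₁, F₂, F₃, g0, g1, g2, g3, r, hr, c12, c23, c30⟩ := hω
  obtain ⟨hs, hk₀, hμ, hw1, hw2, -, -, -, -, -, -, -, -, -, -, -, -, -, hn, hμM, hR₀, hR₀M, -, -⟩ := hV.ifacts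
  have hw : 1 ≤ P.w := by omega
  have hnM : P.n ≤ P.M := by omega
  have hk1 : 1 ≤ P.k₀ := by omega
  have hKM : ∀ j < P.K, 128 * (trapScale P.k₀ j : ℤ) < P.M := fun j hj => by
    have := P.scale_le hj; have h' : 32 * (trapScale P.k₀ j : ℤ) ≤ P.μ := by exact_mod_cast this
    linarith
  have hR₀1 : 1 ≤ P.R₀ := by omega
  have hM1 : 1 ≤ 2 * P.M := by omega
  obtain ⟨g0a, g0b⟩ := g0; obtain ⟨g1a, g1b⟩ := g1; obtain ⟨g2a, g2b⟩ := g2; obtain ⟨g3a, g3b⟩ := g3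
  -- windows
  obtain ⟨ν₀, hν₀, t0a, t0b⟩ := exists_owindow P hw (t := F₀.z 1) (by linarith) (by linarith)
  obtain ⟨ν₁, hν₁, t1a, t1b⟩ := exists_owindow P hw (t := F₁.z 1) (by linarith) (by linarith)
  obtain ⟨ν₂, hν₂, t2a, t2b⟩ := exists_owindow P hw (t := F₂.z 1) (by linarith) (by linarith)
  obtain ⟨ν₃, hν₃, t3a, t3b⟩ := exists_owindow P hw (t := F₃.z 1) (by linarith) (by linarith)
  -- the tip data
  set D : TipData := ⟨i, ![F₀.j, F₁.j, F₂.j, F₃.j], ![ν₀, ν₁, ν₂, ν₃], ![F₀.z 1, F₁.z 1, F₂.z 1, F₃.z 1]⟩ with hD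
  -- row gaps of tips of different colours
  have zg := fun {χ χ' : SiteConfig (Site 2)} (hχ : χ' = χᶜ) (Fo : TrapFencedArm P.M P.n P.k₀ P.K χ)
    (Fc : TrapFencedArm P.M P.n P.k₀ P.K χ') => TrapFencedArm.zgap_compl hnM hk1 hKM hχ Fo Fc
  have g01 : i 0 = i 1 → F₀.z 1 + 8 * F₀.k < F₁.z 1 ∨ F₁.z 1 + 8 * F₁.k < F₀.z 1 := fun h => zg (by rw [h]) F₀ F₁
  have g03 : i 0 = i 3 → F₀.z 1 + 8 * F₀.k < F₃.z 1 ∨ F₃.z 1 + 8 * F₃.k < F₀.z 1 := fun h => zg (by rw [h]) F₀ F₃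
  have g21 : i 2 = i 1 → F₂.z 1 + 8 * F₂.k < F₁.z 1 ∨ F₁.z 1 + 8 * F₁.k < F₂.z 1 := fun h => zg (by rw [h]) F₂ F₁
  have g23 : i 2 = i 3 → F₂.z 1 + 8 * F₂.k < F₃.z 1 ∨ F₃.z 1 + 8 * F₃.k < F₂.z 1 := fun h => zg (by rw [h]) F₂ F₃
  -- the certificate, linearly
  have n0 := F₀.triNorm_frameIso_z (hi 0); have n1 := F₁.triNorm_frameIso_z (hi 1)
  have n2 := F₂.triNorm_frameIso_z (hi 2); have n3 := F₃.triNorm_frameIso_z (hi 3)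
  obtain ⟨sb1, sb2⟩ := sbtw_of_hexShift_lt hM1 hr n1 n2 n3 n0 c12 c23 c30
  have hGood : D.Good P :=
    { hi := hi
      hj := by intro a; fin_cases a <;> [exact F₀.j_lt; exact F₁.j_lt; exact F₂.j_lt; exact F₃.j_lt]
      hν := by intro a; fin_cases a <;> [exact hν₀; exact hν₁; exact hν₂; exact hν₃]
      hζ := by intro a; fin_cases a <;> [exact ⟨t0a, t0b⟩; exact ⟨t1a, t1b⟩; exact ⟨t2a, t2b⟩; exact ⟨t3a, t3b⟩]
      hgood := by intro a; fin_cases a <;> [exact ⟨g0a, g0b⟩; exact ⟨g1a, g1b⟩; exact ⟨g2a, g2b⟩; exact ⟨g3a, g3b⟩]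
      hdiff := by
        intro a b hpar hab
        fin_cases a <;> fin_cases b <;>
          first
            | exact (hpar (by decide)).elim
            | exact g01 hab | exact (g01 hab.symm).symm | exact g03 hab | exact (g03 hab.symm).symm
            | exact g21 hab | exact (g21 hab.symm).symm | exact g23 hab | exact (g23 hab.symm).symm
      hsame02 := by
        intro h02
        change i 0 = i 2 at h02
        have e2 : hexPos (2 * P.M) (frameIso (i 2) F₂.z) = hexPos (2 * P.M) (frameIso (i 0) F₂.z) := by
          rw [hexPos_frameIso_eq_frKey F₂.z_mem (by linarith) (hi 2), hexPos_frameIso_eq_frKey F₂.z_mem (by linarith) (hi 0)]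
          exact congrArg (fun x => frKey P.M x (F₂.z 1)) h02.symm
        have e0 : hexPos (2 * P.M) (frameIso (i 0) F₀.z) = hexPos (2 * P.M) (frameIso (i 2) F₀.z) := by
          rw [hexPos_frameIso_eq_frKey F₀.z_mem (by linarith) (hi 0), hexPos_frameIso_eq_frKey F₀.z_mem (by linarith) (hi 2)]
          exact congrArg (fun x => frKey P.M x (F₀.z 1)) h02
        rcases sb2 with h | h
        · have h' := h.symm'
          rw [e2] at h'
          obtain ⟨hc, hsb⟩ := frame_eq_and_row_sbtw hR₀1 (hi 0) (hi 1) F₀.z_mem F₁.z_mem F₂.z_mem ⟨g0a, g0b⟩ ⟨g1a, g1b⟩ ⟨g2a, g2b⟩ h'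
          exact ⟨1, by decide, hc, hsb⟩
        · rw [e0] at h
          obtain ⟨hc, hsb⟩ := frame_eq_and_row_sbtw hR₀1 (hi 2) (hi 3) F₂.z_mem F₃.z_mem F₀.z_mem ⟨g2a, g2b⟩ ⟨g3a, g3b⟩ ⟨g0a, g0b⟩ h
          exact ⟨3, by decide, hc.trans h02.symm, hsb.symm'⟩
      hsame13 := by
        intro h13
        change i 1 = i 3 at h13
        have e3 : hexPos (2 * P.M) (frameIso (i 3) F₃.z) = hexPos (2 * P.M) (frameIso (i 1) F₃.z) := by
          rw [hexPos_frameIso_eq_frKey F₃.z_mem (by linarith) (hi 3), hexPos_frameIso_eq_frKey F₃.z_mem (by linarith) (hi 1)]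
          exact congrArg (fun x => frKey P.M x (F₃.z 1)) h13.symm
        rcases sb1 with h | h
        · rw [e3] at h
          obtain ⟨hc, hsb⟩ := frame_eq_and_row_sbtw hR₀1 (hi 1) (hi 2) F₁.z_mem F₂.z_mem F₃.z_mem ⟨g1a, g1b⟩ ⟨g2a, g2b⟩ ⟨g3a, g3b⟩ h
          exact ⟨2, by decide, hc, hsb⟩
        · rw [e3] at h
          obtain ⟨hc, hsb⟩ := frame_eq_and_row_sbtw hR₀1 (hi 1) (hi 0) F₁.z_mem F₀.z_mem F₃.z_mem ⟨g1a, g1b⟩ ⟨g0a, g0b⟩ ⟨g3a, g3b⟩ h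
          exact ⟨0, by decide, hc, hsb⟩ }
  -- targets and the routing certificate
  obtain ⟨tc, htc, htgt⟩ := TipData.exists_tgt (P := P) D
  have hP6 : (6 * ((2 * P.M : ℕ) : ℤ)) = 12 * (P.M : ℤ) := by push_cast; ring
  have hkz : ∀ a, ∀ {z : Site 2}, z ∈ trapO P.M → -(2 * (P.M : ℤ)) + P.R₀ ≤ z 1 → D.ζ a = z 1 →
      hexPos (2 * P.M) (frameIso (i a) z) = D.κz P a := by
    intro a z hz hz1 hζ
    rw [hexPos_frameIso_eq_frKey hz (by linarith) (hi a)]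
    show frKey P.M (D.i a) (z 1) = frKey P.M (D.i a) (D.ζ a)
    rw [hζ]
  have k0 := hkz 0 F₀.z_mem g0a rfl; have k1 := hkz 1 F₁.z_mem g1a rfl
  have k2 := hkz 2 F₂.z_mem g2a rfl; have k3 := hkz 3 F₃.z_mem g3a rfl
  rw [hexShift_eq_cyc, hexShift_eq_cyc, hP6] at c12 c23 c30
  rw [k1, k2] at c12; rw [k2, k3] at c23; rw [k3, k0] at c30
  have hb := hexPos_range hM1 hr
  obtain ⟨R, hR⟩ := TipData.exists_route hV hGood htc htgt ⟨hexPos (2 * P.M) r, hb.1, by push_cast at hb; linarith [hb.2], c12, c23, c30⟩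
  refine ⟨TipData.slot P D tc R, TipData.slot_mem_slot4Finset hV hGood htc,
    ⟨fun e => hGood.hi (R.tip e), fun e => hGood.hj (R.tip e), htc, fun e => laneLevel_lt _ _ _⟩, TipData.routeOK_slot hV hGood htc htgt hR, ?_⟩
  -- the arms
  have harm0 : ∃ F : TrapFencedArm P.M P.n P.k₀ P.K (frameConfig (D.i 0) (colCfg (decide (((0 : Fin 4) : ℕ) % 2 = 0)) ω)),
      (-(2 * (P.M : ℤ)) + P.R₀ ≤ F.z 1 ∧ F.z 1 ≤ -(P.R₀ : ℤ)) ∧ F.j = D.j 0 ∧ D.T P 0 ≤ F.z 1 ∧ F.z 1 < D.T P 0 + P.w := by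
    rw [show decide (((0 : Fin 4) : ℕ) % 2 = 0) = true from rfl, colCfg_true]
    exact ⟨F₀, ⟨g0a, g0b⟩, rfl, t0a, t0b⟩
  have harm1 : ∃ F : TrapFencedArm P.M P.n P.k₀ P.K (frameConfig (D.i 1) (colCfg (decide (((1 : Fin 4) : ℕ) % 2 = 0)) ω)),
      (-(2 * (P.M : ℤ)) + P.R₀ ≤ F.z 1 ∧ F.z 1 ≤ -(P.R₀ : ℤ)) ∧ F.j = D.j 1 ∧ D.T P 1 ≤ F.z 1 ∧ F.z 1 < D.T P 1 + P.w := by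
    rw [show decide (((1 : Fin 4) : ℕ) % 2 = 0) = false from rfl, frameConfig_colCfg, colCfg_false]
    exact ⟨F₁, ⟨g1a, g1b⟩, rfl, t1a, t1b⟩
  have harm2 : ∃ F : TrapFencedArm P.M P.n P.k₀ P.K (frameConfig (D.i 2) (colCfg (decide (((2 : Fin 4) : ℕ) % 2 = 0)) ω)),
      (-(2 * (P.M : ℤ)) + P.R₀ ≤ F.z 1 ∧ F.z 1 ≤ -(P.R₀ : ℤ)) ∧ F.j = D.j 2 ∧ D.T P 2 ≤ F.z 1 ∧ F.z 1 < D.T P 2 + P.w := by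
    rw [show decide (((2 : Fin 4) : ℕ) % 2 = 0) = true from rfl, colCfg_true]
    exact ⟨F₂, ⟨g2a, g2b⟩, rfl, t2a, t2b⟩
  have harm3 : ∃ F : TrapFencedArm P.M P.n P.k₀ P.K (frameConfig (D.i 3) (colCfg (decide (((3 : Fin 4) : ℕ) % 2 = 0)) ω)),
      (-(2 * (P.M : ℤ)) + P.R₀ ≤ F.z 1 ∧ F.z 1 ≤ -(P.R₀ : ℤ)) ∧ F.j = D.j 3 ∧ D.T P 3 ≤ F.z 1 ∧ F.z 1 < D.T P 3 + P.w := by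
    rw [show decide (((3 : Fin 4) : ℕ) % 2 = 0) = false from rfl, frameConfig_colCfg, colCfg_false]
    exact ⟨F₃, ⟨g3a, g3b⟩, rfl, t3a, t3b⟩
  have harm : ∀ a : Fin 4, ∃ F : TrapFencedArm P.M P.n P.k₀ P.K (frameConfig (D.i a) (colCfg (decide ((a : ℕ) % 2 = 0)) ω)),
      (-(2 * (P.M : ℤ)) + P.R₀ ≤ F.z 1 ∧ F.z 1 ≤ -(P.R₀ : ℤ)) ∧ F.j = D.j a ∧ D.T P a ≤ F.z 1 ∧ F.z 1 < D.T P a + P.w := by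
    intro a
    fin_cases a <;> assumption
  rw [Set.mem_iInter]
  intro e
  have hc : Slot4.col e = decide (((R.tip e : Fin 4) : ℕ) % 2 = 0) := by unfold Slot4.col; rw [hR.tip_parity]
  show ∃ F : TrapFencedArm P.M P.n P.k₀ P.K (frameConfig (D.i (R.tip e)) (colCfg (Slot4.col e) ω)),
    (-(2 * (P.M : ℤ)) + P.R₀ ≤ F.z 1 ∧ F.z 1 ≤ -(P.R₀ : ℤ)) ∧ F.j = D.j (R.tip e) ∧ D.T P (R.tip e) ≤ F.z 1 ∧ F.z 1 < D.T P (R.tip e) + P.w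
  rw [hc]
  exact harm (R.tip e)

/-! ### The landing inequality at `p` -/

/-- **The landing bound at `p` for `OutMidTiny4`.** For a valid outer rung `P`, a parameter `p` with
the frame-continuation input `hF` and the RSW input `hrsw` (aspect ratio `ρ ≥ 64`, sizes up to `Ncap`)
at `p` and at `1 - p`:
`P_p(OutMidTiny4 M n k₀ K R₀) · (c_F c^{B+3})⁴ ≤ (∏_q slot4Bound P q ^ 4) · P_p(extFourArmQ n (4M))`
(`LL 7 + μ ≤ 2ρε`, `N'/16 ≤ Ncap`, `Gr 7 ≤ B`). [cite: Nolin2008, §4.4 p. 12 with §4.3 Prop. 12 (i), Lemma 13 (arXiv 0711.4948: proof of Thm. 10; Prop. 11, Lemma 12)] -/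
theorem real_outMidTiny4_le_at {P : OParams} (hV : P.Valid) (p : unitInterval) {cF c : ℝ} {ρ Ncap B : ℕ}
    (hF : ∀ q : unitInterval, (q = p ∨ q = unitInterval.symm p) →
      ∀ (z : Site 2) (k : ℕ), 1 ≤ k → k ≤ Ncap → cF ≤ (triSitePercolation q).real (triFrameAt z k))
    (hrsw : ∀ q : unitInterval, (q = p ∨ q = unitInterval.symm p) →
      ∀ n : ℕ, 1 ≤ ⌊(ρ : ℝ) * n⌋₊ → n ≤ Ncap → c ≤ triLRCrossingProb q ⌊(ρ : ℝ) * n⌋₊ n)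
    (hρ : 64 ≤ ρ) (hc : 0 ≤ c) (hcF : 0 ≤ cF) (hsp : P.LL 7 + P.μ ≤ ρ * (2 * P.ε)) (hcap : P.N' / 16 ≤ Ncap) (hB : P.Gr 7 ≤ B) :
    (triSitePercolation p).real (OutMidTiny4 P.M P.n P.k₀ P.K P.R₀) * (cF * c ^ (B + 3)) ^ 4 ≤
      ((∏ q : Fin 7, slot4Bound P q ^ 4 : ℕ) : ℝ) * (triSitePercolation p).real (extFourArmQ P.n (4 * P.M)) := by
  classical
  set S := (slot4Finset P).filter (fun σ => σ.InRange P ∧ Slot4.RouteOK P σ) with hS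
  have hsub : OutMidTiny4 P.M P.n P.k₀ P.K P.R₀ ⊆ ⋃ σ ∈ S, ⋂ e, σ.armE P e := fun ω hω => by
    obtain ⟨σ, hσ, hin, hro, hmem⟩ := exists_slot_of_mem hV hω
    exact Set.mem_iUnion₂.2 ⟨σ, Finset.mem_filter.2 ⟨hσ, hin, hro⟩, hmem⟩
  have hS' : ∀ σ ∈ S, σ.InRange P ∧ Slot4.RouteOK P σ := fun σ hσ => (Finset.mem_filter.1 hσ).2
  have h1 := real_biUnion_arms_le hV p hF hrsw hρ hc hcF hsp hcap hB S hS'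
  have hcard : (S.card : ℝ) ≤ ((∏ q : Fin 7, slot4Bound P q ^ 4 : ℕ) : ℝ) := by
    exact_mod_cast (Finset.card_filter_le _ _).trans (card_slot4Finset P).le
  have hq0 : 0 ≤ (cF * c ^ (B + 3)) ^ 4 := by positivity
  calc (triSitePercolation p).real (OutMidTiny4 P.M P.n P.k₀ P.K P.R₀) * (cF * c ^ (B + 3)) ^ 4
      ≤ (triSitePercolation p).real (⋃ σ ∈ S, ⋂ e, σ.armE P e) * (cF * c ^ (B + 3)) ^ 4 :=
        mul_le_mul_of_nonneg_right (measureReal_mono hsub (measure_ne_top _ _)) hq0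
    _ ≤ S.card * (triSitePercolation p).real (extFourArmQ P.n (4 * P.M)) := h1
    _ ≤ ((∏ q : Fin 7, slot4Bound P q ^ 4 : ℕ) : ℝ) * (triSitePercolation p).real (extFourArmQ P.n (4 * P.M)) :=
        mul_le_mul_of_nonneg_right hcard measureReal_nonneg

end Literature.Probability.Percolation
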